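import Summits.CriticalPhenomena.Ising3DConformalLimit.Theorems.PrecisionLaplacianDirectCorrelationStableTailSlabModeExpDecayDiagHausdorff

/-!
# Diagonal line holomorphy, auxiliary file 7: the symmetric ONE-STEP diagonal transfer matrix of the
# rotated torus, two-insertion traces, and their spectral sums

Helper file for the sub-stub `stub_slabModeExpDecay_auxDiagLineHol` (brick of `stub_slabModeExpDecay`)
of line `self-energy-pick-inversion`, crux `PrecisionLaplacian.DirectCorrelationStableTail`
(stmt-CriticalPhenomena-4799). Pure theorem file.

On the rotated torus of `RotatedTorus`/`RotatedTorusLayers` the Boltzmann weight factorises along the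
diagonal as `∏_m e^{βE(R_m)} e^{βE(S_m)} K(R_m,S_m) K(R_{m+1},S_m)` over the even layers `R_m` and the
odd layers `S_m`. Twisting the odd layers by the in-layer reflection `w ↦ -w` turns this into a
HOMOGENEOUS cyclic chain of length `2N` for the **symmetric one-step matrix**
`T(R, S) = e^{βE(R)/2} K(R, S∘(-)) e^{βE(S)/2}` (`K(R, S∘(-)) = K(S, R∘(-))` because the even→odd and
odd→even couplings `C(R,S) = ∑_w R(w)(S(w) + S(w+e_b))` are exchanged by the reflection), whose square
is the two-step matrix `diagTransfer` of `RotatedTorusLayers`: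

* `diagCoupling_neg_neg`, `diagLayerEnergy_neg` : the reflection identities;
* `sum_exp_mul_mul_eq_trace_oneStep` (registered sub-goal `stub_slabModeExpDecay_auxDiagLineHol8`):
  `∑_σ e^{-βH(σ)} f(R₀(σ)) g(X_m(σ)) = Tr(diag f · T^m · diag g · T^{2N-m})` for `m ∈ ℤ/2Nℤ`, where
  `X_{2n} = R_n` and `X_{2n+1} = S_n∘(-)`;
* `trace_diag_pow_diag_pow_eq_sum_of_isHermitian` : for a real symmetric (not necessarily positive)
  `T`, `Tr(diag f T^m diag f T^{M-m}) = ∑_{k,l} c_{kl} λ_l^m λ_k^{M-m}` with `c_{kl} ≥ 0` and REAL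
  eigenvalues `λ_k`;
* `exists_atomicMeasure_of_spectralSum_real` : for an EVEN length `M` the atomic measure
  `∑_{k,l} (c_{kl} λ_k^M/Z) δ_{λ_l/λ_k}` on `ℝ` is positive with moments `Z⁻¹ ∑ c_{kl} λ_l^m λ_k^{M-m}`,
  `m < M`.

References: Aizenman–Duminil-Copin (2021), proof of Prop. 5.4 (iii) (two-step transfer `TT*`);
Schultz–Mattis–Lieb (1964), §II; Glimm–Jaffe, *Quantum Physics*, §6.
-/

noncomputable section

namespace Summit.CriticalPhenomena.Ising3DConformalLimit.Cruxes.DirectCorrelationStableTail.SelfEnergyPickInversion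

open MeasureTheory Filter Topology Set Matrix
open scoped BigOperators
open Literature.Probability.LatticeModels

/-! ### The in-layer reflection `w ↦ -w` -/

section Reflection

variable {d'' N : ℕ}

/-- `σ_w(L∘(-)) = σ_{-w}(L)`. [folklore] -/
theorem spinAt_comp_neg (L : Layer (d'' + 1) N) (w : TorusSite (d'' + 1) N) :
    spinAt w (fun w' => L (-w')) = spinAt (-w) L := rfl

variable [NeZero N]

/-- **The couplings are exchanged by the reflection**: `C(A∘(-), B∘(-)) = C(B, A)`. [folklore] -/
theorem diagCoupling_neg_neg (A B : Layer (d'' + 1) N) :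
    diagCoupling (fun w => A (-w)) (fun w => B (-w)) = diagCoupling B A := by
  simp only [diagCoupling, spinAt_comp_neg, mul_add, Finset.sum_add_distrib]
  congr 1
  · rw [← Equiv.sum_comp (Equiv.neg (TorusSite (d'' + 1) N))]
    exact Finset.sum_congr rfl fun w _ => by simp [mul_comm]
  · rw [← Equiv.sum_comp ((Equiv.neg (TorusSite (d'' + 1) N)).trans
      (Equiv.subRight (Pi.single 0 1 : TorusSite (d'' + 1) N)))]
    refine Finset.sum_congr rfl fun w _ => ?_
    simp only [Equiv.trans_apply, Equiv.subRight_apply, Equiv.neg_apply]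
    rw [show -(-w - Pi.single (0 : Fin (d'' + 1)) (1 : ZMod N)) = w + Pi.single 0 1 by abel,
      show -(-w - Pi.single (0 : Fin (d'' + 1)) (1 : ZMod N) + Pi.single 0 1) = w by abel, mul_comm]

/-- `C(A, B∘(-)) = C(B, A∘(-))`. [folklore] -/
theorem diagCoupling_comp_neg_symm (A B : Layer (d'' + 1) N) :
    diagCoupling A (fun w => B (-w)) = diagCoupling B (fun w => A (-w)) := by
  have h := diagCoupling_neg_neg (fun w => A (-w)) B
  simp only [neg_neg] at h
  exact h

/-- The layer energy is invariant under the reflection. [folklore] -/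
theorem diagLayerEnergy_neg (h : ℝ) (L : Layer (d'' + 1) N) :
    diagLayerEnergy h (fun w => L (-w)) = diagLayerEnergy h L := by
  simp only [diagLayerEnergy, spinAt_comp_neg]
  congr 1
  · rw [Finset.sum_comm]
    conv_rhs => rw [Finset.sum_comm]
    refine Finset.sum_congr rfl fun j _ => ?_
    rw [← Equiv.sum_comp ((Equiv.neg (TorusSite (d'' + 1) N)).trans
      (Equiv.subRight (Pi.single j.succ 1 : TorusSite (d'' + 1) N)))]
    refine Finset.sum_congr rfl fun w _ => ?_
    simp only [Equiv.trans_apply, Equiv.subRight_apply, Equiv.neg_apply]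
    rw [show -(-w - Pi.single (j.succ : Fin (d'' + 1)) (1 : ZMod N)) = w + Pi.single j.succ 1 by abel,
      show -(-w - Pi.single (j.succ : Fin (d'' + 1)) (1 : ZMod N) + Pi.single j.succ 1) = w by abel, mul_comm]
  · congr 1
    rw [← Equiv.sum_comp (Equiv.neg (TorusSite (d'' + 1) N))]
    exact Finset.sum_congr rfl fun w _ => by simp


/-- `(e^{βE/2})² = e^{βE}`. [folklore] -/
theorem diagHalfWeight_mul_self (β h : ℝ) (L : Layer (d'' + 1) N) :
    diagHalfWeight β h L * diagHalfWeight β h L = diagWeight β h L := by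
  rw [diagHalfWeight, diagWeight, ← Real.exp_add]; congr 1; ring

/-- The half weight is invariant under the reflection. [folklore] -/
theorem diagHalfWeight_neg (β h : ℝ) (L : Layer (d'' + 1) N) :
    diagHalfWeight β h (fun w => L (-w)) = diagHalfWeight β h L := by
  rw [diagHalfWeight, diagHalfWeight, diagLayerEnergy_neg]

/-- The coupling matrix under the reflection: `K(A∘(-), B∘(-)) = K(B, A)` and
`K(A, B∘(-)) = K(B, A∘(-))`. [folklore] -/
theorem diagK_neg_neg (β : ℝ) (A B : Layer (d'' + 1) N) :
    diagK β (fun w => A (-w)) (fun w => B (-w)) = diagK β B A ∧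
    diagK β A (fun w => B (-w)) = diagK β B (fun w => A (-w)) := by
  constructor
  · simp only [diagK, diagCoupling_neg_neg]
  · simp only [diagK, diagCoupling_comp_neg_symm A B]

end Reflection

/-! ### The homogeneous one-step chain -/

section OneStep

variable {d'' N : ℕ} [NeZero N]

/-- **Configuration sums with one even and one arbitrary layer observable are two-insertion traces of
the symmetric one-step matrix.** For `N ≥ 3`, `f, g : Layer → ℝ` and `m ∈ ℤ/2Nℤ`,
`∑_σ e^{-βH(σ)} f(R₀(σ)) g(X_m(σ)) = Tr(diag f · T^m · diag g · T^{2N-m})`, where `X_{2n} = R_n`,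
`X_{2n+1} = S_n∘(-)` and `T(R,S) = e^{βE(R)/2} K(R, S∘(-)) e^{βE(S)/2}`. [folklore] -/
theorem sum_exp_mul_mul_eq_trace_oneStep (hN : 3 ≤ N) (β h : ℝ) (f g : Layer (d'' + 1) N → ℝ) (m : ZMod (2 * N)) :
    ∑ σ : SpinConfig (RotSite d'' N), Real.exp (-β * isingHamiltonian (rotGraph d'' N) Finset.univ h .free σ) *
        (f (evenLayer σ 0) * (if (parityEquiv m).2 = 0 then g (evenLayer σ (parityEquiv m).1)
          else g (fun w => oddLayer σ (parityEquiv m).1 (-w)))) =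
      (diagonal f * (Matrix.of fun R S : Layer (d'' + 1) N =>
          diagHalfWeight β h R * diagK β R (fun w => S (-w)) * diagHalfWeight β h S) ^ m.val * diagonal g *
        (Matrix.of fun R S : Layer (d'' + 1) N =>
          diagHalfWeight β h R * diagK β R (fun w => S (-w)) * diagHalfWeight β h S) ^ (2 * N - m.val)).trace := by
  classical
  haveI : NeZero (2 * N) := ⟨by have := NeZero.ne N; omega⟩
  set T : Matrix (Layer (d'' + 1) N) (Layer (d'' + 1) N) ℝ := Matrix.of fun R S : Layer (d'' + 1) N =>
    diagHalfWeight β h R * diagK β R (fun w => S (-w)) * diagHalfWeight β h S with hT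
  -- the interleaving-with-twist bijection `Y ↦ (R, S)`, `R_n = Y_{2n}`, `S_n = Y_{2n+1}∘(-)`
  let Ψ : (ZMod (2 * N) → Layer (d'' + 1) N) ≃ (ZMod N → Layer (d'' + 1) N) × (ZMod N → Layer (d'' + 1) N) :=
    { toFun := fun Y => (fun n => Y (twoMul n), fun n => fun w => Y (twoMul n + 1) (-w))
      invFun := fun RS a => if (parityEquiv a).2 = 0 then RS.1 (parityEquiv a).1
        else fun w => RS.2 (parityEquiv a).1 (-w)
      left_inv := fun Y => by
        funext a
        simp only
        set p := parityEquiv a with hp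
        have ha : a = parityEquiv.symm p := by rw [hp, Equiv.symm_apply_apply]
        obtain ⟨n, ε⟩ := p
        have hε : ε = 0 ∨ ε = 1 := by fin_cases ε <;> simp
        rcases hε with rfl | rfl
        · simp only [Fin.isValue, ↓reduceIte]
          rw [ha, parityEquiv_symm_zero]
        · simp only [Fin.isValue, one_ne_zero, ↓reduceIte, neg_neg]
          rw [ha, parityEquiv_symm_one]
      right_inv := fun RS => by
        obtain ⟨R, S⟩ := RS
        simp only [parityEquiv_twoMul, parityEquiv_twoMul_add_one, Fin.isValue, ↓reduceIte, one_ne_zero,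
          neg_neg] }
  have hΨ1 : ∀ Y n, (Ψ Y).1 n = Y (twoMul n) := fun Y n => rfl
  have hΨ2 : ∀ Y n, (Ψ Y).2 n = fun w => Y (twoMul n + 1) (-w) := fun Y n => rfl
  -- reindex the configuration sum
  rw [← Equiv.sum_comp rotLayersEquiv.symm, ← Equiv.sum_comp Ψ]
  have key : ∀ Y : ZMod (2 * N) → Layer (d'' + 1) N,
      Real.exp (-β * isingHamiltonian (rotGraph d'' N) Finset.univ h .free (rotLayersEquiv.symm (Ψ Y))) *
        (f (evenLayer (rotLayersEquiv.symm (Ψ Y)) 0) *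
          (if (parityEquiv m).2 = 0 then g (evenLayer (rotLayersEquiv.symm (Ψ Y)) (parityEquiv m).1)
            else g (fun w => oddLayer (rotLayersEquiv.symm (Ψ Y)) (parityEquiv m).1 (-w)))) =
      f (Y 0) * g (Y m) * ∏ a : ZMod (2 * N), T (Y a) (Y (a + 1)) := by
    intro Y
    rw [exp_neg_mul_isingHamiltonian_rot_eq hN, evenLayer_symm, oddLayer_symm]
    simp only [hΨ1, hΨ2, twoMul_zero, neg_neg]
    -- the observable at time `m`
    have hobs : (if (parityEquiv m).2 = 0 then g (Y (twoMul (parityEquiv m).1))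
        else g (fun w => Y (twoMul (parityEquiv m).1 + 1) w)) = g (Y m) := by
      set p := parityEquiv m with hp
      have hm : m = parityEquiv.symm p := by rw [hp, Equiv.symm_apply_apply]
      obtain ⟨n, ε⟩ := p
      have hε : ε = 0 ∨ ε = 1 := by fin_cases ε <;> simp
      rcases hε with rfl | rfl
      · simp only [Fin.isValue, ↓reduceIte]
        rw [hm, parityEquiv_symm_zero]
      · simp only [Fin.isValue, one_ne_zero, ↓reduceIte]
        rw [hm, parityEquiv_symm_one]
    rw [hobs]
    -- the weight
    have hprod : ∏ a : ZMod (2 * N), T (Y a) (Y (a + 1)) =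
        ∏ n : ZMod N, (T (Y (twoMul n)) (Y (twoMul n + 1)) * T (Y (twoMul n + 1)) (Y (twoMul (n + 1)))) := by
      rw [← Equiv.prod_comp parityEquiv.symm, Fintype.prod_prod_type]
      refine Finset.prod_congr rfl fun n _ => ?_
      rw [Fin.prod_univ_two, parityEquiv_symm_zero, parityEquiv_symm_one, twoMul_add_one_add_one]
    rw [hprod]
    have hstep : ∀ n : ZMod N, T (Y (twoMul n)) (Y (twoMul n + 1)) * T (Y (twoMul n + 1)) (Y (twoMul (n + 1))) =
        (diagHalfWeight β h (Y (twoMul n)) * diagHalfWeight β h (Y (twoMul (n + 1)))) *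
        (diagWeight β h (fun w => Y (twoMul n + 1) (-w)) *
          diagK β (Y (twoMul n)) (fun w => Y (twoMul n + 1) (-w)) *
          diagK β (Y (twoMul (n + 1))) (fun w => Y (twoMul n + 1) (-w))) := by
      intro n
      simp only [hT, Matrix.of_apply]
      rw [(diagK_neg_neg β (Y (twoMul n + 1)) (Y (twoMul (n + 1)))).2, ← diagHalfWeight_mul_self,
        diagHalfWeight_neg]
      ring
    simp_rw [hstep]
    have hshift : ∏ n : ZMod N, diagHalfWeight β h (Y (twoMul (n + 1))) = ∏ n : ZMod N, diagHalfWeight β h (Y (twoMul n)) :=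
      Fintype.prod_equiv (Equiv.addRight (1 : ZMod N)) _ _ (fun _ => rfl)
    have hW : ∏ n : ZMod N, ((diagHalfWeight β h (Y (twoMul n)) * diagHalfWeight β h (Y (twoMul (n + 1)))) *
        (diagWeight β h (fun w => Y (twoMul n + 1) (-w)) *
          diagK β (Y (twoMul n)) (fun w => Y (twoMul n + 1) (-w)) *
          diagK β (Y (twoMul (n + 1))) (fun w => Y (twoMul n + 1) (-w)))) =
        ∏ n : ZMod N, (diagWeight β h (Y (twoMul n)) * diagWeight β h (fun w => Y (twoMul n + 1) (-w)) *
          diagK β (Y (twoMul n)) (fun w => Y (twoMul n + 1) (-w)) *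
          diagK β (Y (twoMul (n + 1))) (fun w => Y (twoMul n + 1) (-w))) := by
      rw [Finset.prod_mul_distrib, Finset.prod_mul_distrib, hshift, ← Finset.prod_mul_distrib]
      simp_rw [diagHalfWeight_mul_self]
      rw [← Finset.prod_mul_distrib]
      exact Finset.prod_congr rfl fun n _ => by ring
    rw [hW]
    ring
  simp_rw [key]
  exact sum_zmod_mul_mul_prod_cyclic_eq_trace T f g m

/-- The one-step matrix is symmetric. [folklore] -/
theorem oneStep_isHermitian (β h : ℝ) :
    (Matrix.of fun R S : Layer (d'' + 1) N =>
      diagHalfWeight β h R * diagK β R (fun w => S (-w)) * diagHalfWeight β h S).IsHermitian := by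
  rw [Matrix.IsHermitian, Matrix.conjTranspose_eq_transpose_of_trivial]
  ext R S
  simp only [Matrix.transpose_apply, Matrix.of_apply]
  rw [(diagK_neg_neg β S R).2]
  ring

end OneStep

/-! ### Spectral sums for a real symmetric matrix -/

section Spectral

variable {ι : Type*} [Fintype ι] [DecidableEq ι]

/-- **Spectral form of two-insertion traces, real symmetric case.** For a real symmetric matrix `T`
and a real diagonal observable `f` there are real `λ_k` (the eigenvalues) and symmetric `c_{kl} ≥ 0`
with `Tr(diag f · Tⁿ · diag f · Tᵐ) = ∑_{k,l} c_{kl} λ_lⁿ λ_kᵐ` for all `n, m`. [folklore] -/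
theorem trace_diag_pow_diag_pow_eq_sum_of_isHermitian {T : Matrix ι ι ℝ} (hT : T.IsHermitian) (f : ι → ℝ) :
    ∃ (ev : ι → ℝ) (c : ι → ι → ℝ), (∀ k l, 0 ≤ c k l) ∧ (∀ k l, c k l = c l k) ∧
      ∀ n m : ℕ, (diagonal f * T ^ n * diagonal f * T ^ m).trace = ∑ k, ∑ l, c k l * (ev l ^ n * ev k ^ m) := by
  -- adapted from `trace_diagonal_pow_diagonal_pow_eq_sum` (`TorusTransferSpectral`), positivity dropped
  classical
  set U : Matrix ι ι ℝ := (hT.eigenvectorUnitary : Matrix ι ι ℝ) with hU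
  set ev : ι → ℝ := hT.eigenvalues with hev
  have hspec : ∀ M : ℕ, T ^ M = U * diagonal (fun i => ev i ^ M) * star U := by
    intro M
    have h := congrArg (fun X : Matrix ι ι ℝ => X ^ M) hT.spectral_theorem
    rw [← map_pow, diagonal_pow, Unitary.conjStarAlgAut_apply] at h
    rw [h]
    rfl
  set M : Matrix ι ι ℝ := star U * diagonal f * U with hM
  have hMapply : ∀ k l, M k l = ∑ a, U a k * f a * U a l := by
    intro k l
    simp only [hM, Matrix.mul_apply, Matrix.star_apply, star_trivial, Matrix.diagonal_apply, mul_ite,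
      mul_zero, Finset.sum_ite_eq', Finset.mem_univ, if_true]
  have hMsym : ∀ k l, M k l = M l k := by
    intro k l
    simp only [hMapply]
    exact Finset.sum_congr rfl fun a _ => by ring
  refine ⟨ev, fun k l => M k l * M l k, fun k l => ?_, fun k l => mul_comm _ _, fun n m => ?_⟩
  · show 0 ≤ M k l * M l k
    rw [hMsym l k]; exact mul_self_nonneg _
  set Dn : Matrix ι ι ℝ := diagonal fun i => ev i ^ n with hDn
  set Dm : Matrix ι ι ℝ := diagonal fun i => ev i ^ m with hDm
  calc (diagonal f * T ^ n * diagonal f * T ^ m).trace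
      = (diagonal f * (U * Dn * star U) * diagonal f * (U * Dm * star U)).trace := by rw [hspec n, hspec m]
    _ = ((diagonal f * U * Dn * (star U * diagonal f * U) * Dm) * star U).trace := by simp only [Matrix.mul_assoc]
    _ = (star U * (diagonal f * U * Dn * (star U * diagonal f * U) * Dm)).trace := Matrix.trace_mul_comm _ _
    _ = (M * Dn * M * Dm).trace := by simp only [hM, Matrix.mul_assoc]
    _ = ∑ k, ∑ l, M k l * M l k * (ev l ^ n * ev k ^ m) := by
        simp only [Matrix.trace, Matrix.diag_apply, hDm, hDn, Matrix.mul_apply, Matrix.diagonal_apply,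
          mul_ite, mul_zero, Finset.sum_ite_eq', Finset.mem_univ, if_true, Finset.sum_mul]
        exact Finset.sum_congr rfl fun k _ => Finset.sum_congr rfl fun l _ => by ring

/-- **The atomic measure of a two-sided spectral sum.** For weights `c_{kl} ≥ 0`, REAL `λ_k`, `Z > 0`
and an EVEN length `M ≥ 1`, the finitely supported positive measure
`ν = ∑_{k,l} (c_{kl} λ_k^M / Z) δ_{λ_l/λ_k}` on `ℝ` has moments `∫ xᵐ dν = Z⁻¹ ∑_{k,l} c_{kl} λ_lᵐ λ_k^{M-m}`
for `0 ≤ m < M`. [folklore] -/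
theorem exists_atomicMeasure_of_spectralSum_real {κ : Type*} [Fintype κ] (cc : κ → κ → ℝ) (ev : κ → ℝ)
    (hcc : ∀ k l, 0 ≤ cc k l) {Z : ℝ} (hZ : 0 < Z) {M : ℕ} (hM : Even M) (hM0 : M ≠ 0) :
    ∃ ν : Measure ℝ, IsFiniteMeasure ν ∧ (∀ g : ℝ → ℝ, Integrable g ν) ∧
      ∀ m : ℕ, m < M → ∫ t, t ^ m ∂ν = Z⁻¹ * ∑ k, ∑ l, cc k l * (ev l ^ m * ev k ^ (M - m)) := by
  -- adapted from `exists_atomicMeasure_of_spectralSum` (file `…SlabSpectralRepresentation`)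
  classical
  set w : κ → κ → ℝ := fun k l => cc k l * ev k ^ M / Z with hw
  set x : κ → κ → ℝ := fun k l => ev l / ev k with hx
  have hw0 : ∀ k l, 0 ≤ w k l := fun k l =>
    div_nonneg (mul_nonneg (hcc k l) (hM.pow_nonneg (ev k))) hZ.le
  let ν : Measure ℝ := ∑ p : κ × κ, ENNReal.ofReal (w p.1 p.2) • Measure.dirac (x p.1 p.2)
  have hνapply : ∀ s : Set ℝ, MeasurableSet s →
      ν s = ∑ p : κ × κ, ENNReal.ofReal (w p.1 p.2) * s.indicator 1 (x p.1 p.2) := by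
    intro s hs
    simp only [ν, Measure.coe_finsetSum, Finset.sum_apply, Measure.smul_apply, smul_eq_mul,
      Measure.dirac_apply' _ hs]
  have hint : ∀ g : ℝ → ℝ, Integrable g ν := fun g =>
    integrable_finsetSum_measure.2 fun p _ =>
      (AxisSpectral.integrable_dirac_real g _).smul_measure ENNReal.ofReal_ne_top
  have hintegral : ∀ g : ℝ → ℝ, ∫ t, g t ∂ν = ∑ p : κ × κ, w p.1 p.2 * g (x p.1 p.2) := by
    intro g
    rw [integral_finsetSum_measure fun p _ =>
      (AxisSpectral.integrable_dirac_real g _).smul_measure ENNReal.ofReal_ne_top]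
    refine Finset.sum_congr rfl fun p _ => ?_
    rw [integral_smul_measure, integral_dirac, ENNReal.toReal_ofReal (hw0 _ _), smul_eq_mul]
  refine ⟨ν, ⟨?_⟩, hint, fun m hm => ?_⟩
  · rw [hνapply _ MeasurableSet.univ]
    exact ENNReal.sum_lt_top.2 fun p _ => ENNReal.mul_lt_top ENNReal.ofReal_lt_top (by simp)
  · rw [hintegral, Fintype.sum_prod_type]
    have hterm : ∀ k l, w k l * x k l ^ m = Z⁻¹ * (cc k l * (ev l ^ m * ev k ^ (M - m))) := by
      intro k l
      simp only [hw, hx]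
      rcases eq_or_ne (ev k) 0 with hk | hk
      · rw [hk, zero_pow hM0, zero_pow (by omega : M - m ≠ 0)]; simp
      · rw [div_pow]
        have hsplit : ev k ^ M = ev k ^ m * ev k ^ (M - m) := by
          rw [← pow_add]; congr 1; omega
        rw [hsplit]
        field_simp
    simp_rw [hterm, ← Finset.mul_sum]

end Spectral

/-- **Registered auxiliary stub `stub_slabModeExpDecay_auxDiagLineHol8`** (sub-goal of the brick
`stub_slabModeExpDecay_auxDiagLineHol` of `stub_slabModeExpDecay`): configuration sums of the rotated
torus with one even-layer and one arbitrary-layer observable are two-insertion traces of the symmetric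
one-step diagonal transfer matrix (`sum_exp_mul_mul_eq_trace_oneStep`). [folklore] -/
theorem stub_slabModeExpDecay_auxDiagLineHol8 : ∀ (d'' N : ℕ) [NeZero N], 3 ≤ N → ∀ (β h : ℝ) (f g : Layer (d'' + 1) N → ℝ) (m : ZMod (2 * N)), ∑ σ : SpinConfig (RotSite d'' N), Real.exp (-β * isingHamiltonian (rotGraph d'' N) Finset.univ h .free σ) * (f (evenLayer σ 0) * (if (parityEquiv m).2 = 0 then g (evenLayer σ (parityEquiv m).1) else g (fun w => oddLayer σ (parityEquiv m).1 (-w)))) = (Matrix.diagonal f * (Matrix.of fun R S : Layer (d'' + 1) N => diagHalfWeight β h R * diagK β R (fun w => S (-w)) * diagHalfWeight β h S) ^ m.val * Matrix.diagonal g * (Matrix.of fun R S : Layer (d'' + 1) N => diagHalfWeight β h R * diagK β R (fun w => S (-w)) * diagHalfWeight β h S) ^ (2 * N - m.val)).trace :=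
  fun _ _ _ hN β h f g m => sum_exp_mul_mul_eq_trace_oneStep hN β h f g m

end Summit.CriticalPhenomena.Ising3DConformalLimit.Cruxes.DirectCorrelationStableTail.SelfEnergyPickInversion

end
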